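import Summits.QuantumFields.BalabanUV.T4Continuum.Support.VariationalTowerClosed
import Summits.QuantumFields.BalabanUV.T4Continuum.Support.BalabanDeltaKIdentification

/-!
# T⁴ programme, spine node NE2 (U1a), lane P2 — SUPPLIER ITEM s9 «T0-X9 WIRING»: the `U = 1` VECTOR DICTIONARY
# `effMat = Δ_k (1.65) = (Q_k𝒢Q_k*)⁻¹ − a` between the variational route, the β cell and lane P1, and the X8 → X9 RATE TRANSFER at `θ = L⁻²`
# (`t4/skeletons/NE2-t4-ne2-p2.md` v0.7 §2.A «T0-X9» ∕ §7 s9; cell `pub-balaban`; NE2 formalisation swarm leaf prover 05, GEN 3)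

HONEST FRAMING (T4-DAG p. 1).  Rung (B)+1 only — NOT infinite volume, NOT a mass gap, NOT Clay.  NE2 is NOT IN PRINT and NOT proved here.
`U = 1` ONLY (no background: NOT the canonical pair, NOT NE2⁺); fixed finite torus, linear layer, operator norm.  [folklore]
bookkeeping between kernel objects ALREADY in the tree plus one resolvent-identity transfer; statements and rates OURS (Bałaban prints no
η-rate; King's (4.18)/(4.38) is the scalar template).  Inputs BY NAME: lane P2 `VariationalTower.effMat` / `re_form_effMat` and
`VariationalTowerClosed.opNorm_effMat_succ_sub_le_holds` (X8 = the `U = 1` effective actions `Δ_k`, rate `Cop·(L⁻²)^k`, NO hypothesis);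
the β cell's `Beta.BlockEffectiveAction.DelK` ((1.65), `DelK_eq : Δ_k = (QGQ*)⁻¹ − a·1`); lane P1's `BalabanHardMinimizer.DeltaK = covB⁻¹ − a•1`,
`isUnit_covB_det`, `re_form_DeltaK_nonneg`, `BalabanDeltaKIdentification.DeltaK_eq_DelK` / `DelKlev`, `BalabanAveragedCoerciveTower.covBlev`
(X9/X11's unit image `(L^k)^d·Q_k𝒢Q_kᴴ`, (1.71)), `CoerciveInverseTower.opNorm_inv_sub_inv_le`; b05's `B5Hk163Form166.HkOp_eq_Hk`,
`B5Action121.curl_adjoint_curl`.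

CONTENTS.
* §1 **`effMat_eq_DelK`**: the variational tower's matrix `n^{−d}·H_kᴴ(Δ − ∂∂*)H_k` IS the tree's typed (1.65) operator `Δ_k` (both are
  `n^{−d}·H_kᴴ(∂*∂)H_k`; `½(CurlOp)ᴴCurlOp = Δ − ∂∂*`, `HkOp = H_k`); **`effMat_eq_DeltaK`** (= lane P1's `covB⁻¹ − a•1`);
  **`effMat_add_smul_one`** / **`inv_effMat_add_smul_one`**: `effMat + a•1 = covB⁻¹`, `(effMat + a•1)⁻¹ = covB = n^d·Q_k𝒢Q_kᴴ` — X9/X11's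
  unit image as the RESOLVENT of X8 (dictionary D/T0-X9 of the skeleton); `DelKlev_eq_effMat`.
* §2 `re_form_effMat_nonneg`, **`coercive_effMat_add`**: `effMat + a•1` is `a`-coercive.
* §3 THE TRANSFER: `lev_eq_pow`, `effMat_congr`, `opNorm_effMat_lev_succ_sub_le` (X8 at the levels `lev L k`), `inv_covBlev_eq` /
  `opNorm_inv_covBlev_succ_sub_le_sq` (X11's unit image `(Q_k𝒢Q_kᴴ)⁻¹ = effMat + a•1` moves at X8's rate), `covBlev_eq_inv`,
  **`opNorm_covBlev_succ_sub_le_sq`**: `‖covBlev (k+1) − covBlev k‖ ≤ a⁻²·Cop(d, 4d/γ₀)·(L⁻²)^k` — NO hypothesis; this SHARPENS lane P1's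
  `opNorm_covBlev_succ_sub_le` (rate `CQB·L^{−k}`, from (1.89)) to the variational rate `θ = L⁻²` for the averaged PROPAGATORS;
  **`oneStepAveragedLaw_covBlev`** (the NE5 socket's currency, identity averagings, `r = 1`) and **`towerLimitRate_covBlev_sq`** (the
  Spine's `TowerLimitRate (fun _ ↦ 1) 1 covBlev (a⁻²Cop) (L⁻²)`); **`covBlev_tendsto_sq`** /
  **`DelKlev_tendsto_sq`**: the towers X9-unit (`covBlev`) and X8 (`DelKlev`) converge with `‖X_k − X_∞‖ ≤ C·(L⁻²)^k/(1 − L⁻²)`, `L ≥ 2`.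
* §4 the same in lane P1's composite-tower presentation: **`opNorm_unitCovB_succ_sub_le_sq`**, **`localRate_unitCovB_sq`** (the cell's
  `T4EtaRateMin.LocalRate` shape for the species «averaged free covariance at `U = 1`» at rate `L⁻²` — an instance, NOT NE3),
  `unitCovB_tendsto_sq`.

HONEST DEPENDENCY (cell, verbatim): continuum YM on T⁴ ⇐ BetaPertH ∧ nine spine estimates (0/9 proved); BetaPertH ⇐ (D1) ∧ (D4) ∧ CAP+tail;
G-an2-4 gates asym, D1 and NE2/3/4.  Nothing printed is a hypothesis; no `def … : Prop` fact; no `sorry`; axioms standard.  NE2 NOT proved;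
spine PROVED 0/9 unchanged.
-/

noncomputable section

open scoped BigOperators ComplexConjugate Matrix Matrix.Norms.L2Operator Topology
open Filter

namespace Summit.QuantumFields.BalabanUV.T4Continuum.VariationalDelKBridge

open Literature.MathematicalPhysics.QuantumFieldTheory.Balaban1983to89
open Literature.MathematicalPhysics.QuantumFieldTheory.Balaban1983to89.B5Prop11Plancherel (Tor fine)
open Literature.MathematicalPhysics.QuantumFieldTheory.Balaban1983to89.B5Prop11Lower (nsq nsq_nonneg star_dotProduct_self)
open Literature.MathematicalPhysics.QuantumFieldTheory.Balaban1983to89.B5Action121 (CurlOp GradOp curl_adjoint_curl Lap_eq_LapV)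
open Literature.MathematicalPhysics.QuantumFieldTheory.Balaban1983to89.B5Hk163RDiv (DstarD)
open Literature.MathematicalPhysics.QuantumFieldTheory.Balaban1983to89.B5Hk163Torus (HkOp)
open Literature.MathematicalPhysics.QuantumFieldTheory.Balaban1983to89.B5Hk163Form166 (HkOp_eq_Hk)
open Literature.MathematicalPhysics.QuantumFieldTheory.Balaban1983to89.B5QGQ171Unit (covB)
open Literature.MathematicalPhysics.QuantumFieldTheory.Balaban1983to89.B5G183RateUnitTower (lev lev_neZero)
open Literature.MathematicalPhysics.QuantumFieldTheory.Balaban1983to89.T4GaugeActionRate (gam0 gam0_pos)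
open Summit.QuantumFields.BalabanUV.T4Continuum.CovariantAveragingTower (OneStepAveragedLaw TowerLimitRate opNorm_one_le
  towerLimitRate_of_oneStepAveragedLaw)
open Summit.QuantumFields.BalabanUV.T4Continuum.CoerciveInverseTower (Coercive opNorm_inv_sub_inv_le)
open Summit.QuantumFields.BalabanUV.T4Continuum.VariationalTower (effMat re_form_effMat Cop)
open Summit.QuantumFields.BalabanUV.T4Continuum.VariationalTowerClosed (opNorm_effMat_succ_sub_le_holds)
open Summit.QuantumFields.BalabanUV.T4Continuum.BalabanHardMinimizer (DeltaK isUnit_covB_det re_form_DeltaK_nonneg)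
open Summit.QuantumFields.BalabanUV.T4Continuum.BalabanDeltaKIdentification (DeltaK_eq_DelK DelKlev)
open Literature.MathematicalPhysics.QuantumFieldTheory.Balaban1983to89.T4EtaRateMin (LocalRate)
open Summit.QuantumFields.BalabanUV.T4Continuum.BalabanAveragedCoerciveTower (covBlev covBlev_eq_submatrix opNorm_submatrix_equiv
  submatrix_sub_eq unitIdx)
open Summit.QuantumFields.BalabanUV.T4Continuum.BalabanAveragedTowerUnit (idx one_le_lev' unitCovB covBReadings norm_entry_le_opNorm)

variable {d : ℕ}

/-! ## §1 The dictionary: `effMat = Δ_k = covB⁻¹ − a•1` -/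

section Dict

variable (n : ℕ) [NeZero n] (hn : 1 ≤ n) (M : Fin d → ℕ) [hM : ∀ μ, NeZero (M μ)] (a : ℝ) (ha : 0 < a)

/-- `½·(CurlOp)ᴴ·CurlOp = Δ − ∂∂*` (`B5Action121.curl_adjoint_curl`, `B5Hk163RDiv.DstarD`). [cite: Balaban1984PropagatorsI, (1.21) p.21,
(1.69) p.29 (objects); proof ours] -/
theorem half_curl_adjoint_curl :
    (1 / 2 : ℂ) • ((CurlOp (fine n M) (n : ℂ))ᴴ * CurlOp (fine n M) (n : ℂ)) = DstarD n M := by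
  rw [curl_adjoint_curl, smul_smul, DstarD, Lap_eq_LapV]
  norm_num

/-- **THE VARIATIONAL TOWER's MATRIX IS THE TREE's TYPED (1.65) OPERATOR**: `effMat n M = Δ_k` (`Beta.BlockEffectiveAction.DelK`; both are
`n^{−d}·H_kᴴ(∂*∂)H_k` with `HkOp = H_k`). [cite: Balaban1984PropagatorsI, (1.65) p.29 (object); proof ours] -/
theorem effMat_eq_DelK : effMat n M = Beta.BlockEffectiveAction.DelK n hn M a ha := by
  rw [effMat, Beta.BlockEffectiveAction.DelK, half_curl_adjoint_curl, ← HkOp_eq_Hk n hn M a ha, Matrix.mul_assoc]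

/-- … and IS lane P1's hard effective operator `Δ_K = covB⁻¹ − a•1` (`BalabanHardMinimizer.DeltaK`). [folklore] -/
theorem effMat_eq_DeltaK : effMat n M = DeltaK n hn M a ha := by
  rw [effMat_eq_DelK n hn M a ha, DeltaK_eq_DelK]

/-- **`effMat + a•1 = covB⁻¹`** (`covB = n^d·Q_k𝒢Q_kᴴ`, (1.71)). [cite: Balaban1984PropagatorsI, (1.71) p.30 (object); proof ours] -/
theorem effMat_add_smul_one :
    effMat n M + (a : ℂ) • (1 : Matrix (Tor M × Fin d) (Tor M × Fin d) ℂ) = (covB n hn M a ha)⁻¹ := by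
  rw [effMat_eq_DeltaK n hn M a ha, DeltaK, sub_add_cancel]

/-- **X9/X11's UNIT IMAGE IS THE RESOLVENT OF X8**: `(effMat + a•1)⁻¹ = covB = n^d·Q_k𝒢Q_kᴴ` (dictionary D/T0-X9). [cite:
Balaban1984PropagatorsI, (1.65) p.29, (1.71) p.30 (objects); proof ours] -/
theorem inv_effMat_add_smul_one :
    (effMat n M + (a : ℂ) • (1 : Matrix (Tor M × Fin d) (Tor M × Fin d) ℂ))⁻¹ = covB n hn M a ha := by
  rw [effMat_add_smul_one n hn M a ha, Matrix.nonsing_inv_nonsing_inv _ (isUnit_covB_det n hn M a ha)]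

/-! ## §2 Positivity and coercivity of the shifted effective operator -/

/-- `0 ≤ re ⟨B, effMat B⟩` (it is the effective action). [folklore] -/
theorem re_form_effMat_nonneg (B : Tor M × Fin d → ℂ) : 0 ≤ (star B ⬝ᵥ (effMat n M *ᵥ B)).re := by
  have hn1 : 1 ≤ n := Nat.one_le_iff_ne_zero.mpr (NeZero.ne n)
  rw [effMat_eq_DeltaK n hn1 M 1 one_pos]
  exact re_form_DeltaK_nonneg n hn1 M 1 one_pos B

/-- **`effMat + a•1` IS `a`-COERCIVE** (any real `a`; used with `a > 0`). [folklore] -/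
theorem coercive_effMat_add : Coercive a (effMat n M + (a : ℂ) • (1 : Matrix (Tor M × Fin d) (Tor M × Fin d) ℂ)) := by
  intro x
  have h0 := re_form_effMat_nonneg n M x
  rw [Matrix.add_mulVec, dotProduct_add, Complex.add_re, Matrix.smul_mulVec, Matrix.one_mulVec, dotProduct_smul,
    star_dotProduct_self, smul_eq_mul, ← Complex.ofReal_mul, Complex.ofReal_re]
  linarith

end Dict

/-! ## §3 The transfer X8 → X9 along the levels `n_k = L^k` -/

section Tower

variable (L : ℕ) [NeZero L] (M : Fin d → ℕ) [hM : ∀ μ, NeZero (M μ)] (a : ℝ) (ha : 0 < a)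

/-- `n_k = L^k` (the level sequence `lev` is defined by recursion). [folklore] -/
theorem lev_eq_pow (L k : ℕ) : lev L k = L ^ k := by
  induction k with
  | zero => rfl
  | succ k ih => rw [pow_succ, mul_comm, ← ih]; rfl

/-- `effMat` along equal levels (the carrier `Tor M × Fin d` does not depend on the level). [folklore] -/
theorem effMat_congr {n n' : ℕ} [NeZero n] [NeZero n'] (h : n = n') : effMat n M = effMat n' M := by
  subst h
  rfl

/-- `effMat (lev L k) M = effMat (L^k) M`. [folklore] -/
theorem effMat_lev (k : ℕ) : effMat (lev L k) M = effMat (L ^ k) M := effMat_congr M (lev_eq_pow L k)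

/-- X8 at the levels `lev L k`: `‖Δ^{(n_{k+1})} − Δ^{(n_k)}‖ ≤ Cop(d, 4d/γ₀)·(L⁻²)^k` (`VariationalTowerClosed`, NO hypothesis). [folklore] -/
theorem opNorm_effMat_lev_succ_sub_le (k : ℕ) :
    ‖effMat (lev L (k + 1)) M - effMat (lev L k) M‖ ≤ Cop d (4 * d / gam0 d) * (((L : ℝ) ^ 2)⁻¹) ^ k := by
  rw [effMat_lev, effMat_lev]
  exact opNorm_effMat_succ_sub_le_holds M L k

/-- lane P1's tower of (1.65) operators IS the variational tower: `DelKlev L M a ha k = effMat (lev L k) M`. [folklore] -/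
theorem DelKlev_eq_effMat (k : ℕ) : DelKlev L M a ha k = effMat (lev L k) M :=
  (effMat_eq_DelK (lev L k) (one_le_lev' L k) M a ha).symm

/-- X11's unit image `(Q_k𝒢Q_kᴴ)⁻¹` ((1.69)/(3.132) at `U = 1`) along the tower IS the shifted X8: `(covBlev k)⁻¹ = effMat (lev L k) + a•1`.
[cite: Balaban1984PropagatorsI, (1.69) p.29 (object); proof ours] -/
theorem inv_covBlev_eq (k : ℕ) :
    (covBlev L M a ha k)⁻¹ = effMat (lev L k) M + (a : ℂ) • (1 : Matrix (Tor M × Fin d) (Tor M × Fin d) ℂ) :=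
  (effMat_add_smul_one (lev L k) (one_le_lev' L k) M a ha).symm

/-- **X11's unit image moves at X8's rate**: `‖(covBlev (k+1))⁻¹ − (covBlev k)⁻¹‖ ≤ Cop(d, 4d/γ₀)·(L⁻²)^k` (the shift `a•1` cancels) — NO
hypothesis; sharpens the inverse-rate conjunct of lane P1's `BalabanAveragedCoerciveTower.covBlev_tendsto` (`γ⁻²·CQB·L^{−k}`). [folklore] -/
theorem opNorm_inv_covBlev_succ_sub_le_sq (k : ℕ) :
    ‖(covBlev L M a ha (k + 1))⁻¹ - (covBlev L M a ha k)⁻¹‖ ≤ Cop d (4 * d / gam0 d) * (((L : ℝ) ^ 2)⁻¹) ^ k := by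
  rw [inv_covBlev_eq, inv_covBlev_eq, add_sub_add_right_eq_sub]
  exact opNorm_effMat_lev_succ_sub_le L M k

/-- X9's unit image along the tower as a resolvent: `covBlev k = (effMat (lev L k) + a•1)⁻¹`. [folklore] -/
theorem covBlev_eq_inv (k : ℕ) :
    covBlev L M a ha k = (effMat (lev L k) M + (a : ℂ) • (1 : Matrix (Tor M × Fin d) (Tor M × Fin d) ℂ))⁻¹ :=
  (inv_effMat_add_smul_one (lev L k) (one_le_lev' L k) M a ha).symm

/-- **THE X8 → X9 TRANSFER AT `θ = L⁻²`, NO HYPOTHESIS**: `‖covBlev (k+1) − covBlev k‖ ≤ a⁻²·Cop(d, 4d/γ₀)·(L⁻²)^k` — the resolvent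
identity `‖A⁻¹ − B⁻¹‖ ≤ a⁻²‖A − B‖` for the `a`-coercive `effMat + a•1` at adjacent levels, and X8's variational rate.  Sharpens lane P1's
`BalabanAveragedCoerciveTower.opNorm_covBlev_succ_sub_le` (rate `L^{−k}`).  Rate and constant OURS. [folklore] -/
theorem opNorm_covBlev_succ_sub_le_sq (k : ℕ) :
    ‖covBlev L M a ha (k + 1) - covBlev L M a ha k‖ ≤ (a⁻¹) ^ 2 * (Cop d (4 * d / gam0 d) * (((L : ℝ) ^ 2)⁻¹) ^ k) := by
  rw [covBlev_eq_inv L M a ha (k + 1), covBlev_eq_inv L M a ha k]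
  refine (opNorm_inv_sub_inv_le ha (coercive_effMat_add (lev L (k + 1)) M a) (coercive_effMat_add (lev L k) M a)).trans ?_
  rw [add_sub_add_right_eq_sub]
  exact mul_le_mul_of_nonneg_left (opNorm_effMat_lev_succ_sub_le L M k) (sq_nonneg _)

/-- **X9's UNIT IMAGE IN THE NE5 SOCKET's CURRENCY** (identity averagings on the fixed unit torus, `r = 1`):
`OneStepAveragedLaw (fun _ ↦ 1) 1 (covBlev L M a ha) (k ↦ a⁻²·Cop·(L⁻²)^k)` — NO hypothesis. [folklore] -/
theorem oneStepAveragedLaw_covBlev :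
    OneStepAveragedLaw (ι := fun _ => Tor M × Fin d) (fun _ => (1 : Matrix (Tor M × Fin d) (Tor M × Fin d) ℂ)) 1
      (covBlev L M a ha) (fun k => (a⁻¹) ^ 2 * Cop d (4 * d / gam0 d) * (((L : ℝ) ^ 2)⁻¹) ^ k) := by
  intro k
  have h := opNorm_covBlev_succ_sub_le_sq L M a ha k
  rw [← mul_assoc] at h
  simpa only [Matrix.one_mul, Matrix.conjTranspose_one, Matrix.mul_one, Complex.ofReal_one, inv_one, one_smul,
    one_mul] using h

/-- **… hence the Spine's `TowerLimitRate`** for X9's unit image with identity averagings: `TowerLimitRate (fun _ ↦ 1) 1 (covBlev L M a ha)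
(a⁻²·Cop) (L⁻²)` (`L ≥ 2`; `CovariantAveragingTower.towerLimitRate_of_oneStepAveragedLaw`) — NO hypothesis. [folklore] -/
theorem towerLimitRate_covBlev_sq (hL : 2 ≤ L) :
    TowerLimitRate (ι := fun _ => Tor M × Fin d) (fun _ => (1 : Matrix (Tor M × Fin d) (Tor M × Fin d) ℂ)) 1
      (covBlev L M a ha) ((a⁻¹) ^ 2 * Cop d (4 * d / gam0 d)) (((L : ℝ) ^ 2)⁻¹) := by
  have hL1 : (1 : ℝ) < L := by exact_mod_cast (lt_of_lt_of_le one_lt_two hL : 1 < L)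
  have hρ1 : ((L : ℝ) ^ 2)⁻¹ < 1 := inv_lt_one_of_one_lt₀ (by nlinarith)
  refine towerLimitRate_of_oneStepAveragedLaw _ one_pos (fun k => ?_) _ hρ1 (oneStepAveragedLaw_covBlev L M a ha)
  rw [inv_one]
  calc ‖(1 : Matrix (Tor M × Fin d) (Tor M × Fin d) ℂ)‖ ^ 2 ≤ (1 : ℝ) ^ 2 :=
        pow_le_pow_left₀ (norm_nonneg _) (opNorm_one_le (ι := fun _ => Tor M × Fin d) k) 2
    _ = 1 := one_pow 2

/-- **THE TOWER OF AVERAGED PROPAGATORS CONVERGES AT RATE `L⁻²`** (`L ≥ 2`; X9/X11's unit image at `U = 1`):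
`‖covBlev k − c_∞‖ ≤ a⁻²·Cop·(L⁻²)^k/(1 − L⁻²)`.  Rate and constant OURS. [folklore] -/
theorem covBlev_tendsto_sq (hL : 2 ≤ L) :
    ∃ cinf : Matrix (Tor M × Fin d) (Tor M × Fin d) ℂ,
      Tendsto (covBlev L M a ha) atTop (𝓝 cinf) ∧
      ∀ k, ‖covBlev L M a ha k - cinf‖
        ≤ (a⁻¹) ^ 2 * Cop d (4 * d / gam0 d) * (((L : ℝ) ^ 2)⁻¹) ^ k / (1 - ((L : ℝ) ^ 2)⁻¹) := by
  set ρ : ℝ := ((L : ℝ) ^ 2)⁻¹ with hρ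
  set C : ℝ := (a⁻¹) ^ 2 * Cop d (4 * d / gam0 d) with hC
  have hL1 : (1 : ℝ) < L := by exact_mod_cast (lt_of_lt_of_le one_lt_two hL : 1 < L)
  have hρ1 : ρ < 1 := inv_lt_one_of_one_lt₀ (by nlinarith)
  have hu : ∀ k, dist (covBlev L M a ha k) (covBlev L M a ha (k + 1)) ≤ C * ρ ^ k := by
    intro k
    rw [dist_eq_norm, ← norm_neg, neg_sub, hC, mul_assoc]
    exact opNorm_covBlev_succ_sub_le_sq L M a ha k
  obtain ⟨cinf, hlim⟩ := cauchySeq_tendsto_of_complete (cauchySeq_of_le_geometric ρ C hρ1 hu)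
  refine ⟨cinf, hlim, fun k => ?_⟩
  rw [← dist_eq_norm]
  exact dist_le_of_le_geometric_of_tendsto ρ C hρ1 hu hlim k

/-- **THE TOWER OF (1.65) EFFECTIVE ACTIONS CONVERGES AT RATE `L⁻²`** (`L ≥ 2`; X8 at `U = 1`, lane P1's `DelKlev` = the β cell's `DelK`
along `n_k = L^k`): `‖Δ_k − Δ_∞‖ ≤ Cop·(L⁻²)^k/(1 − L⁻²)` — sharpens `BalabanDeltaKIdentification.DelKlev_tendsto` (rate `L^{−k}`).
Rate and constant OURS. [folklore] -/
theorem DelKlev_tendsto_sq (hL : 2 ≤ L) :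
    ∃ Dinf : Matrix (Tor M × Fin d) (Tor M × Fin d) ℂ,
      Tendsto (DelKlev L M a ha) atTop (𝓝 Dinf) ∧
      ∀ k, ‖DelKlev L M a ha k - Dinf‖ ≤ Cop d (4 * d / gam0 d) * (((L : ℝ) ^ 2)⁻¹) ^ k / (1 - ((L : ℝ) ^ 2)⁻¹) := by
  set ρ : ℝ := ((L : ℝ) ^ 2)⁻¹ with hρ
  set C : ℝ := Cop d (4 * d / gam0 d) with hC
  have hL1 : (1 : ℝ) < L := by exact_mod_cast (lt_of_lt_of_le one_lt_two hL : 1 < L)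
  have hρ1 : ρ < 1 := inv_lt_one_of_one_lt₀ (by nlinarith)
  have hu : ∀ k, dist (DelKlev L M a ha k) (DelKlev L M a ha (k + 1)) ≤ C * ρ ^ k := by
    intro k
    rw [dist_eq_norm, ← norm_neg, neg_sub, DelKlev_eq_effMat, DelKlev_eq_effMat]
    exact opNorm_effMat_lev_succ_sub_le L M k
  obtain ⟨Dinf, hlim⟩ := cauchySeq_tendsto_of_complete (cauchySeq_of_le_geometric ρ C hρ1 hu)
  refine ⟨Dinf, hlim, fun k => ?_⟩
  rw [← dist_eq_norm]
  exact dist_le_of_le_geometric_of_tendsto ρ C hρ1 hu hlim k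

end Tower

/-! ## §4 The same rate in lane P1's composite-tower presentation `unitCovB` and as the cell's `LocalRate` shape -/

section Unit

variable (L : ℕ) [NeZero L] (M : Fin d → ℕ) [hM : ∀ μ, NeZero (M μ)] (a : ℝ) (ha : 0 < a)

/-- **lane P1's composite-tower images converge one step at rate `L⁻²`**: `‖unitCovB (k+1) − unitCovB k‖ ≤ a⁻²·Cop·(L⁻²)^k`
(`unitCovB k = (L^d)^k·QBtow_k 𝒢^{(L^{−k})} QBtow_kᴴ` is `covBlev k` relabelled, `covBlev_eq_submatrix`) — sharpens
`BalabanAveragedTowerUnit.opNorm_unitCovB_succ_sub_le` (rate `L^{−k}`); NO hypothesis. [folklore] -/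
theorem opNorm_unitCovB_succ_sub_le_sq (k : ℕ) :
    ‖unitCovB L M a ha (k + 1) - unitCovB L M a ha k‖ ≤ (a⁻¹) ^ 2 * (Cop d (4 * d / gam0 d) * (((L : ℝ) ^ 2)⁻¹) ^ k) := by
  rw [← opNorm_submatrix_equiv _ (unitIdx L M).symm, submatrix_sub_eq, ← covBlev_eq_submatrix, ← covBlev_eq_submatrix]
  exact opNorm_covBlev_succ_sub_le_sq L M a ha k

/-- **THE CELL's SHAPE `LocalRate` AT RATE `L⁻²` for the species «(1.18)-averaged free covariance at `U = 1`»**: consecutive levels'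
entries (real and imaginary parts) differ by at most `a⁻²·Cop·(L⁻²)^k` — an INSTANCE (a theorem, no hypothesis), sharpening
`BalabanAveragedTowerUnit.localRate_unitCovB` (rate `L⁻¹`); NOT NE3 (no minimiser is read), NOT NE2⁺ (no background).
[cite: King1986, Lemma 4.5 (4.38) p.674 (shape)] [folklore] -/
theorem localRate_unitCovB_sq :
    LocalRate (covBReadings L M a ha) ((a⁻¹) ^ 2 * Cop d (4 * d / gam0 d)) (((L : ℝ) ^ 2)⁻¹) := by
  intro k _ _ x
  have hstep := opNorm_unitCovB_succ_sub_le_sq L M a ha k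
  rw [← mul_assoc] at hstep
  have hent : ‖(unitCovB L M a ha (k + 1) - unitCovB L M a ha k) x.1.1 x.1.2‖
      ≤ (a⁻¹) ^ 2 * Cop d (4 * d / gam0 d) * (((L : ℝ) ^ 2)⁻¹) ^ k :=
    (norm_entry_le_opNorm _ _ _).trans hstep
  rw [Matrix.sub_apply] at hent
  obtain ⟨⟨i, j⟩, b⟩ := x
  cases b with
  | true =>
    simp only [covBReadings, ↓reduceIte]
    rw [← Complex.sub_re]
    exact (Complex.abs_re_le_norm _).trans hent
  | false =>
    simp only [covBReadings, Bool.false_eq_true, ↓reduceIte]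
    rw [← Complex.sub_im]
    exact (Complex.abs_im_le_norm _).trans hent

/-- **the composite-tower images converge at rate `L⁻²`** (`L ≥ 2`): `‖unitCovB k − c_∞‖ ≤ a⁻²·Cop·(L⁻²)^k/(1 − L⁻²)` — sharpens
`BalabanAveragedTowerUnit.unitCovB_tendsto` (rate `L⁻¹`).  Rate and constant OURS. [folklore] -/
theorem unitCovB_tendsto_sq (hL : 2 ≤ L) :
    ∃ cinf : Matrix (idx L M 0) (idx L M 0) ℂ,
      Tendsto (unitCovB L M a ha) atTop (𝓝 cinf) ∧
      ∀ k, ‖unitCovB L M a ha k - cinf‖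
        ≤ (a⁻¹) ^ 2 * Cop d (4 * d / gam0 d) * (((L : ℝ) ^ 2)⁻¹) ^ k / (1 - ((L : ℝ) ^ 2)⁻¹) := by
  set ρ : ℝ := ((L : ℝ) ^ 2)⁻¹ with hρ
  set C : ℝ := (a⁻¹) ^ 2 * Cop d (4 * d / gam0 d) with hC
  have hL1 : (1 : ℝ) < L := by exact_mod_cast (lt_of_lt_of_le one_lt_two hL : 1 < L)
  have hρ1 : ρ < 1 := inv_lt_one_of_one_lt₀ (by nlinarith)
  have hu : ∀ k, dist (unitCovB L M a ha k) (unitCovB L M a ha (k + 1)) ≤ C * ρ ^ k := by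
    intro k
    rw [dist_eq_norm, ← norm_neg, neg_sub, hC, mul_assoc]
    exact opNorm_unitCovB_succ_sub_le_sq L M a ha k
  obtain ⟨cinf, hlim⟩ := cauchySeq_tendsto_of_complete (cauchySeq_of_le_geometric ρ C hρ1 hu)
  refine ⟨cinf, hlim, fun k => ?_⟩
  rw [← dist_eq_norm]
  exact dist_le_of_le_geometric_of_tendsto ρ C hρ1 hu hlim k

end Unit

end Summit.QuantumFields.BalabanUV.T4Continuum.VariationalDelKBridge

end
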